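import Mathlib.Data.Fin.Tuple.Sort
import Mathlib.Data.Fintype.Perm
import Summits.QuantumFields.YangMills.Theorems.BalabanUVNodesN15KingModelGraphReplacementEngine

/-!
# BalabanUVNodes ∕ N15 — THE KING-MODEL RUNG (PART Γ-a): THE GRAPH HALF OF PROPOSITION 3.6's POWER COUNTING — GENERIC ENGINE: a flat graph on
# NUMBERED vertices with a SPANNING-FOREST ∕ ELIMINATION certificate ⇒ «loop lines by their sup, tree lines by their line sum (3.68), the last vertex by
# |□′|» by leaf-stripping from the top; and the sum over orderings (3.58)–(3.59)
# (Track A, DAG node N15 = NE2; FAN-OUT v1.1 §N15 s3 «KING-MODEL RUNG … NE2's analogue DECIDED in the model»)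

HONEST FRAMING.  Count-neutral (cell `pub-ymgap`, seat `pub-ymgap-dag-n15-e` g27; `--supports stmt-QuantumFields-27366 --as helper` = K3⁸
`SpineGivenEndpointR13SepCoPHV`).  TEMPLATE LITERATURE: C. King, *The U(1) Higgs model. I. The continuum limit*, Commun. Math. Phys. **102** (1986) 649–677
[King1986], proof of Proposition 3.6, pp. 663–664: the POWER COUNTING of a localised graph `E(H(j))` at a fixed slice assignment `j` along an ordering of
its internal lines.  Parts Ι-a–Ι-f typed it for TREE-shaped graphs (structural recursion); part Ι-g typed the slice-sum half ((3.69)–(3.70) iterated) for an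
arbitrary ordering.  THIS FILE is the GRAPH half for GENERAL graphs (loops allowed), generic over finite sorts and nonnegative real majorants, in part Η-a's
flat spelling `graphValLS ω src tgt P vtx p`; part Γ-b puts the slices on it, parts Γ-c∕Γ-d King's `A = 0` propagators by name.  NOT Bałaban's non-abelian
`G(U)` of [B9]; NOT a node discharge; nothing continuum ∕ ℝ⁴ ∕ OS ∕ mass-gap ∕ Clay.  0 `sorry`; standard axioms.  Text layer of pp. 663–664
(`paper:king1986-cmp102-king-u1-higgs-i` p0015–p0016) re-read by this seat 2026-08-29.

THE PRINT.  p. 663 [PDF 15]: *«The resulting product of sums is multiplied out and rewritten as a sum over orderings l = {l(1), …, l(m)} of the m internal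
lines. This is followed by a sum over integers {j_{l(p)}}, p = 1, …, m, compatible with this ordering, meaning j_{l(1)} ≤ j_{l(2)} ≤ … ≤ j_{l(m)} (3.58). A term
with two or more integers equal is arbitrarily assigned to one of the orderings with which it is compatible. … (3.59) … For a fixed ordering l we define a
sequence of subgraphs H₁, …, H_m as follows: H₁ = {the line l(1) and its two vertices}, H_{i+1} = H_i ∪ {the line l(i+1) and its two vertices}. (3.66)»*;
p. 664 [PDF 16]: *«We get an upper bound for this expression by replacing every propagator by the bounds given in Proposition 3.7 and Theorem 3.3, and
bounding vertex functions appropriately (the sources, g, h are bounded by C). … Let x, y be the endpoints of the graph H₁ = l(1); there is a factor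
exp[−δ₀L^{k−j_{l(1)}}|x − y|] present. All the other propagators attached to y carry similar exponential factors, but with j_{l(1)} replaced by some
j_{l(p)} ≥ j_{l(1)}. These propagators are "transferred" to x by using the inequality (3.67) … We then sum over y, giving (3.68) … Graphically, we have shrunk
l(1) to a point in H; the remaining vertices are summed … We continue doing this … eventually shrinking H to one point x. The final sum over j is then
bounded by C, and the sum over x by |□′|. … Finally, there is a sum over orderings of the lines, again depending only on n̄.»*

READING (declared; ours).  Along King's procedure a line `l(i)` either reaches a NEW point of the shrunk graph — then its vertex sum (3.68) is performed,
it is a TREE line (a Kruskal line of the ordering) — or it joins two vertices already shrunk to the same point — then it contributes its SUP (3.63) at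
distance `0`, it is a LOOP line.  At a fixed slice assignment the resulting bound — every line its sup prefactor, every tree line in addition the factor
of (3.68) — needs no transfer (3.67) at all once the loop lines are replaced by their sups: the tree lines then form an honest rooted forest and can be
summed leaf-first in any order.  The ordering decides only WHICH lines are tree lines, i.e. the exponents whose partial sums are King's degrees `D(H_i)`
(3.66) — part Γ-b.  A spanning forest with an elimination order is recorded as a CERTIFICATE on numbered vertices (below); Kruskal's choice along the
ordering reproduces King's degrees, any other forest gives a valid bound with weaker exponents.

WHAT THIS FILE PROVES (namespace `Summit.QuantumFields.YangMills.BalabanUVNodes.N15KingModelRung.Graph`; sites `S` finite nonempty, weight `ω ≥ 0`).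
* §1 `treePin n ω K lo x` — THE PINNED TREE SUM ON NUMBERED VERTICES `0, …, n` (root `0` at `x`; line `i` from the earlier vertex `lo i ≤ i` to `i + 1`,
  oriented nonnegative kernel `K_i`): `Σ_{τ : Fin n → S} ω^n·Π_i K_i(σ(lo i), σ(i+1))`; ★★ **`treePin_le`** — LEAF-STRIPPING FROM THE TOP: vertex sums
  `Σ_a ω·K_i(y, a) ≤ c_i` ⇒ `treePin ≤ Π_i c_i` (induction on `n`, the tuple split `τ = (τ′, a)` = `Fin.snocEquiv`; the top vertex is always a leaf).
* §2 structure `ForestCert n src tgt` (tree lines `tl : Fin n → Λ` injective, earlier endpoints `lo i ≤ i`, `ends`: `tl i` joins `lo i` and `i + 1` in either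
  orientation — part Η-a's `src`∕`tgt` spelling; cf. the fermionic lane's `FST3GraphClassification.FGraph.Joins`∕`IsSpanningTree`, not imported);
  `ForestCert.orient` (the oriented tree kernel), `line_eq_orient`; ★★★ **`graphValLS_le_of_forestCert`**: for `graphValLS ω src tgt P vtx p` on vertices
  `Fin (n+1)` with nonnegative majorants, loop sups `P_ℓ ≤ A_ℓ` (`ℓ ∉ range tl`), tree vertex sums `≤ c_i` (both orientations), a root-placed factor `υ₀`
  (`vtx υ₀ = 0`) with `Σ_x ω·p_{υ₀}(x) ≤ Γ` and sups `p_υ ≤ q_υ` (`υ ≠ υ₀`): `graphValLS ≤ Γ·(Π_{ℓ loop} A_ℓ)·(Π_i c_i)·Π_{υ ≠ υ₀} q_υ`.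
* §3 ★ `sum_le_sum_perm_monotone` — (3.58)–(3.59): for `F ≥ 0`, `Σ_{j : Fin m → β} F j ≤ Σ_{π : Perm (Fin m)} Σ_{j : j ∘ π monotone} F j` (every assignment is
  compatible with `Tuple.sort j`; ties double-counted, print assigns them to one ordering); `sum_comp_perm_eq`, `prod_comp_perm_eq` (re-indexing along `π`).

HONEST SCOPE.  (a) The graph half of pp. 663–664 at a FIXED slice assignment, generic; the slices, the exponents `E_p`, the degrees and their positivity
(§3.5∕Thm 3.5: NOT typed), the `j`-sums (part Ι-g) and King's objects enter in parts Γ-b–Γ-d.  (b) The certificate is DATA: which lines are tree lines is the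
user's choice per ordering (Kruskal = King's `D(H_i)`; no Kruskal construction is typed here).  (c) One root-placed `L¹` factor (King's `|□′|`), the other
one-vertex factors by sup; the exponential tree decay of (3.56) between external points is not displayed.  (d) `S` nonempty (lattices are).  Locators:
[King1986] (3.58)–(3.59) p.663, (3.66) p.663 (foot), (3.67)–(3.70) p.664, p.664 («the sum over x by |□′|», «a sum over orderings of the lines»).
-/
noncomputable section

namespace Summit.QuantumFields.YangMills.BalabanUVNodes.N15KingModelRung.Graph

open scoped BigOperators
open Finset

/-! ## §1 The pinned tree sum on numbered vertices; leaf-stripping from the top -/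

section TreePin
variable {S : Type*} [Fintype S]

/-- **THE PINNED TREE SUM ON NUMBERED VERTICES** `0, 1, …, n`: the root `0` placed at `x`, the vertices `1, …, n` summed with weight `ω` each
(`τ`), and for every `i < n` ONE line from the lower vertex `lo i ≤ i` to the vertex `i + 1` carrying the (oriented, nonnegative) kernel `K i`:
`treePin n ω K lo x = Σ_{τ : Fin n → S} ω^n·Π_i K_i(σ(lo i), σ(i+1))`, `σ = (x, τ)`.  This is the shape King's shrinking procedure leaves once every
loop-closing line has been bounded by its sup: a rooted tree whose every vertex hangs on an EARLIER one.
[cite: King1986, (3.66)–(3.70) p.664 («Graphically, we have shrunk l(1) to a point in H … eventually shrinking H to one point x»)] -/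
def treePin (n : ℕ) (ω : ℝ) (K : Fin n → S → S → ℝ) (lo : Fin n → Fin (n + 1)) (x : S) : ℝ :=
  ∑ τ : Fin n → S, ω ^ n * ∏ i : Fin n, K i ((Fin.cons x τ : Fin (n + 1) → S) (lo i)) ((Fin.cons x τ : Fin (n + 1) → S) i.succ)

/-- the pinned tree sum is nonnegative for nonnegative data. [folklore] -/
theorem treePin_nonneg (n : ℕ) {ω : ℝ} (hω : 0 ≤ ω) (K : Fin n → S → S → ℝ) (hK : ∀ i y a, 0 ≤ K i y a)
    (lo : Fin n → Fin (n + 1)) (x : S) : 0 ≤ treePin n ω K lo x :=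
  sum_nonneg fun _ _ => mul_nonneg (pow_nonneg hω _) (prod_nonneg fun i _ => hK i _ _)

/-- `(i.castSucc).succ = (i.succ).castSucc` (both are `i + 1`). [folklore] -/
theorem succ_castSucc_eq {m : ℕ} (i : Fin m) : (i.castSucc : Fin (m + 1)).succ = (i.succ).castSucc := Fin.ext rfl

/-- ★★ **LEAF-STRIPPING FROM THE TOP — THE POWER COUNTING OF A ROOTED TREE ON NUMBERED VERTICES.**  If every line's kernel has its vertex sum bounded,
`Σ_a ω·K_i(y, a) ≤ c_i` for all `y` (King's (3.68): *«We then sum over y, giving … Combining this factor with the power of L^{j−k} already present … we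
get altogether the exponent D(H₁)»*), and every vertex hangs on an earlier one (`lo i ≤ i`), then `treePin n ω K lo x ≤ Π_i c_i` for every placement `x`
of the root — the top vertex `n` is a leaf (no line starts there), its sum costs `c_{n−1}`, and what is left is the same tree on `n − 1` numbered vertices
(induction; the tuple split `τ = (τ′, a)` is `Fin.snocEquiv`). [cite: King1986, (3.68)–(3.70) p.664 («Graphically, we have shrunk l(1) to a point in H;
the remaining vertices are summed … We continue doing this … eventually shrinking H to one point x»)] -/
theorem treePin_le {ω : ℝ} (hω : 0 ≤ ω) :
    ∀ (n : ℕ) (K : Fin n → S → S → ℝ) (lo : Fin n → Fin (n + 1)) (c : Fin n → ℝ),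
      (∀ i y a, 0 ≤ K i y a) → (∀ i, lo i ≤ i.castSucc) → (∀ i y, ∑ a, ω * K i y a ≤ c i) →
      ∀ x : S, treePin n ω K lo x ≤ ∏ i, c i
  | 0, K, lo, c, _, _, _, x => by simp [treePin]
  | m + 1, K, lo, c, hK, hlo, hc, x => by
      -- the top vertex `m + 1` is a leaf: no lower endpoint equals `last (m+1)`
      have hne : ∀ i : Fin (m + 1), lo i ≠ Fin.last (m + 1) := fun i =>
        Fin.ne_of_lt (lt_of_le_of_lt (hlo i) (Fin.castSucc_lt_last i))
      -- the restricted certificate on the vertices `0, …, m`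
      let lo' : Fin m → Fin (m + 1) := fun i => (lo i.castSucc).castPred (hne i.castSucc)
      have hlo' : ∀ i : Fin m, lo' i ≤ i.castSucc := fun i => (Fin.castPred_le_iff (hne i.castSucc)).2 (hlo i.castSucc)
      have elo : ∀ i : Fin m, lo i.castSucc = (lo' i).castSucc := fun i => (Fin.castSucc_castPred _ (hne i.castSucc)).symm
      let y₀ : Fin (m + 1) := (lo (Fin.last m)).castPred (hne (Fin.last m))
      have ey₀ : lo (Fin.last m) = y₀.castSucc := (Fin.castSucc_castPred _ (hne (Fin.last m))).symm
      have IH := treePin_le hω m (fun i => K i.castSucc) lo' (fun i => c i.castSucc) (fun i => hK i.castSucc) hlo'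
        (fun i y => hc i.castSucc y) x
      -- the sum split `τ = (τ′, a)`, `a` = the placement of the top vertex
      have key : treePin (m + 1) ω K lo x
          = ∑ τ' : Fin m → S, (ω ^ m * ∏ i : Fin m, K i.castSucc ((Fin.cons x τ' : Fin (m + 1) → S) (lo' i))
              ((Fin.cons x τ' : Fin (m + 1) → S) i.succ))
            * ∑ a : S, ω * K (Fin.last m) ((Fin.cons x τ' : Fin (m + 1) → S) y₀) a := by
        unfold treePin
        rw [← (Fin.snocEquiv fun _ => S).sum_comp, Fintype.sum_prod_type, sum_comm]
        refine sum_congr rfl fun τ' _ => ?_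
        rw [mul_sum]
        refine sum_congr rfl fun a _ => ?_
        have hsn : ((Fin.snocEquiv fun _ => S) (a, τ') : Fin (m + 1) → S) = Fin.snoc τ' a := rfl
        rw [hsn, Fin.cons_snoc_eq_snoc_cons, Fin.prod_univ_castSucc]
        have h1 : ∀ i : Fin m, K i.castSucc ((Fin.snoc (Fin.cons x τ' : Fin (m + 1) → S) a : Fin (m + 2) → S) (lo i.castSucc))
              ((Fin.snoc (Fin.cons x τ' : Fin (m + 1) → S) a : Fin (m + 2) → S) i.castSucc.succ)
            = K i.castSucc ((Fin.cons x τ' : Fin (m + 1) → S) (lo' i)) ((Fin.cons x τ' : Fin (m + 1) → S) i.succ) := by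
          intro i
          rw [elo i, Fin.snoc_castSucc, succ_castSucc_eq, Fin.snoc_castSucc]
        have h2 : K (Fin.last m) ((Fin.snoc (Fin.cons x τ' : Fin (m + 1) → S) a : Fin (m + 2) → S) (lo (Fin.last m)))
              ((Fin.snoc (Fin.cons x τ' : Fin (m + 1) → S) a : Fin (m + 2) → S) (Fin.last m).succ)
            = K (Fin.last m) ((Fin.cons x τ' : Fin (m + 1) → S) y₀) a := by
          rw [ey₀, Fin.snoc_castSucc, Fin.succ_last, Fin.snoc_last]
        rw [prod_congr rfl fun i _ => h1 i, h2, pow_succ]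
        ring
      -- bound
      have hc0 : 0 ≤ c (Fin.last m) := (sum_nonneg fun a _ => mul_nonneg hω (hK _ _ a)).trans (hc (Fin.last m) x)
      rw [key, Fin.prod_univ_castSucc]
      calc ∑ τ' : Fin m → S, (ω ^ m * ∏ i : Fin m, K i.castSucc ((Fin.cons x τ' : Fin (m + 1) → S) (lo' i))
              ((Fin.cons x τ' : Fin (m + 1) → S) i.succ))
            * ∑ a : S, ω * K (Fin.last m) ((Fin.cons x τ' : Fin (m + 1) → S) y₀) a
          ≤ ∑ τ' : Fin m → S, (ω ^ m * ∏ i : Fin m, K i.castSucc ((Fin.cons x τ' : Fin (m + 1) → S) (lo' i))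
              ((Fin.cons x τ' : Fin (m + 1) → S) i.succ)) * c (Fin.last m) :=
            sum_le_sum fun τ' _ => mul_le_mul_of_nonneg_left (hc (Fin.last m) _)
              (mul_nonneg (pow_nonneg hω _) (prod_nonneg fun i _ => hK _ _ _))
        _ = treePin m ω (fun i => K i.castSucc) lo' x * c (Fin.last m) := by rw [← sum_mul]; rfl
        _ ≤ (∏ i : Fin m, c i.castSucc) * c (Fin.last m) := mul_le_mul_of_nonneg_right IH hc0

end TreePin

/-! ## §2 Flat graphs on numbered vertices with a spanning-forest certificate: loop lines by sup, tree lines by line sums -/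

section Forest
variable {S : Type*} [Fintype S] [Nonempty S] {Λ Υ : Type*} [Fintype Λ] [DecidableEq Λ] [Fintype Υ] [DecidableEq Υ]

/-- **A SPANNING-FOREST ∕ ELIMINATION CERTIFICATE** for a flat graph with numbered vertices `0, 1, …, n` (root `0`) and internal lines `Λ` (endpoints
`src`, `tgt`): for every vertex `i + 1` ONE distinguished TREE LINE `tl i` joining it to an EARLIER vertex `lo i ≤ i` (in either orientation); the lines
outside the range of `tl` are the LOOP lines.  Along King's ordering of the lines the Kruskal tree lines (those reaching a new point when the graph is
shrunk line by line) form such a certificate after renumbering the vertices in the order they are reached; any other choice is a valid (weaker) one.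
[cite: King1986, (3.66)–(3.67) p.664 («Let x, y be the endpoints of the graph H₁ = l(1) … All the other propagators attached to y … are transferred to x …
Graphically, we have shrunk l(1) to a point in H»)] -/
structure ForestCert (n : ℕ) {Λ : Type*} (src tgt : Λ → Fin (n + 1)) where
  /-- the tree line of the vertex `i + 1` -/
  tl : Fin n → Λ
  /-- distinct vertices have distinct tree lines -/
  tl_injective : Function.Injective tl
  /-- the earlier endpoint of the tree line of `i + 1` -/
  lo : Fin n → Fin (n + 1)
  /-- … is earlier: `lo i ≤ i` -/
  lo_le : ∀ i, lo i ≤ i.castSucc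
  /-- the tree line of `i + 1` joins `lo i` and `i + 1` (either orientation) -/
  ends : ∀ i, (src (tl i) = lo i ∧ tgt (tl i) = i.succ) ∨ (src (tl i) = i.succ ∧ tgt (tl i) = lo i)

variable {n : ℕ} {src tgt : Λ → Fin (n + 1)}

omit [Fintype Λ] [DecidableEq Λ] in
/-- in the second orientation the source is NOT the earlier endpoint (`lo i ≤ i < i + 1`), so `src (tl i) = lo i` decides the orientation. [folklore] -/
theorem ForestCert.src_ne_lo_of_right (F : ForestCert n src tgt) (i : Fin n) (h : src (F.tl i) = i.succ ∧ tgt (F.tl i) = F.lo i) :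
    src (F.tl i) ≠ F.lo i := by
  rw [h.1]
  intro e
  have h1 := F.lo_le i
  rw [← e] at h1
  exact absurd h1 (not_le.2 (Fin.castSucc_lt_succ (i := i)))

/-- **the oriented tree kernel**: the kernel of the tree line of `i + 1`, read from the earlier endpoint to the later one. [folklore] -/
def ForestCert.orient (F : ForestCert n src tgt) (P : Λ → S → S → ℝ) (i : Fin n) (y a : S) : ℝ :=
  if src (F.tl i) = F.lo i then P (F.tl i) y a else P (F.tl i) a y

omit [Fintype S] [Nonempty S] [Fintype Λ] [DecidableEq Λ] in
/-- the line factor of a tree line IS the oriented kernel read at `(σ(lo i), σ(i+1))`. [folklore] -/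
theorem ForestCert.line_eq_orient (F : ForestCert n src tgt) (P : Λ → S → S → ℝ) (i : Fin n) (σ : Fin (n + 1) → S) :
    P (F.tl i) (σ (src (F.tl i))) (σ (tgt (F.tl i))) = F.orient P i (σ (F.lo i)) (σ i.succ) := by
  unfold ForestCert.orient
  rcases F.ends i with h | h
  · rw [if_pos h.1, h.1, h.2]
  · rw [if_neg (F.src_ne_lo_of_right i h), h.1, h.2]

/-- ★★★ **THE GRAPH HALF OF THE POWER COUNTING — «LOOP LINES BY THEIR SUP, TREE LINES BY THEIR LINE SUM, THE LAST VERTEX BY |□′|».**  A flat graph on the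
numbered vertices `0, …, n` with nonnegative line majorants `P_ℓ` and one-vertex majorants `p_υ` (part Η-a's `graphValLS ω src tgt P vtx p`, weight `ω`
per vertex), a spanning-forest certificate `F`, and: sups `P_ℓ ≤ A_ℓ` on the LOOP lines, vertex sums `Σ_a ω·P_{tl i}(y, a), Σ_a ω·P_{tl i}(a, y) ≤ c_i`
on the TREE lines ((3.68)), a root-placed factor `υ₀` (at vertex `0`) with `Σ_x ω·p_{υ₀}(x) ≤ Γ` (King's `|□′|`: `p_{υ₀} = 𝟙_{□′}`) and sups `p_υ ≤ q_υ` on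
the others.  THEN `graphValLS ω src tgt P vtx p ≤ Γ·(Π_{ℓ loop} A_ℓ)·(Π_i c_i)·Π_{υ ≠ υ₀} q_υ`.  Proof: bound the loop lines and the non-root factors
pointwise, split the placement `σ = (x, τ)` (`Fin.consEquiv`), recognise §1's `treePin` of the oriented tree kernels, strip the leaves (`treePin_le`),
and sum the root against `p_{υ₀}`.  This is King's p. 664 procedure with the transfer (3.67) made unnecessary: once the loop-closing lines carry
constants, the tree lines form an honest rooted forest. [cite: King1986, (3.66)–(3.70) p.664 («We get an upper bound for this expression by replacing every
propagator by the bounds given in Proposition 3.7 … We then sum over y, giving (3.68) … eventually shrinking H to one point x. The final sum over j is then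
bounded by C, and the sum over x by |□′|»)] -/
theorem graphValLS_le_of_forestCert (F : ForestCert n src tgt) (vtx : Υ → Fin (n + 1)) {ω : ℝ} (hω : 0 ≤ ω)
    (P : Λ → S → S → ℝ) (hP0 : ∀ ℓ x y, 0 ≤ P ℓ x y) (p : Υ → S → ℝ) (hp0 : ∀ υ x, 0 ≤ p υ x)
    (A : Λ → ℝ) (hA : ∀ ℓ, ℓ ∉ univ.image F.tl → ∀ x y, P ℓ x y ≤ A ℓ)
    (c : Fin n → ℝ) (hc : ∀ i y, ∑ a, ω * P (F.tl i) y a ≤ c i) (hc' : ∀ i y, ∑ a, ω * P (F.tl i) a y ≤ c i)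
    (υ₀ : Υ) (hυ₀ : vtx υ₀ = 0) {Γ : ℝ} (hΓ : ∑ x, ω * p υ₀ x ≤ Γ)
    (q : Υ → ℝ) (hq : ∀ υ, υ ≠ υ₀ → ∀ x, p υ x ≤ q υ) :
    graphValLS ω src tgt P vtx p ≤ Γ * ((∏ ℓ ∈ (univ.image F.tl)ᶜ, A ℓ) * (∏ i, c i) * ∏ υ ∈ univ.erase υ₀, q υ) := by
  obtain ⟨x₀⟩ := ‹Nonempty S›
  -- signs of the constants
  have hA0 : 0 ≤ ∏ ℓ ∈ (univ.image F.tl)ᶜ, A ℓ :=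
    prod_nonneg fun ℓ hℓ => (hP0 ℓ x₀ x₀).trans (hA ℓ (mem_compl.1 hℓ) x₀ x₀)
  have hq0 : 0 ≤ ∏ υ ∈ univ.erase υ₀, q υ :=
    prod_nonneg fun υ hυ => (hp0 υ x₀).trans (hq υ (ne_of_mem_erase hυ) x₀)
  have hc0 : 0 ≤ ∏ i, c i := prod_nonneg fun i _ => (sum_nonneg fun a _ => mul_nonneg hω (hP0 _ _ a)).trans (hc i x₀)
  -- §1's data: the oriented tree kernels
  have hK0 : ∀ i y a, 0 ≤ F.orient P i y a := fun i y a => by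
    unfold ForestCert.orient; split_ifs <;> exact hP0 _ _ _
  have hKc : ∀ i y, ∑ a, ω * F.orient P i y a ≤ c i := fun i y => by
    unfold ForestCert.orient; split_ifs
    · exact hc i y
    · exact hc' i y
  have htree : ∀ x, treePin n ω (F.orient P) F.lo x ≤ ∏ i, c i := treePin_le hω n (F.orient P) F.lo c hK0 F.lo_le hKc
  -- pointwise bound of the integrand at a placement `σ`
  have hpt : ∀ σ : Fin (n + 1) → S,
      (∏ ℓ, P ℓ (σ (src ℓ)) (σ (tgt ℓ))) * ∏ υ, p υ (σ (vtx υ))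
        ≤ (p υ₀ (σ 0) * ∏ i, F.orient P i (σ (F.lo i)) (σ i.succ))
            * ((∏ ℓ ∈ (univ.image F.tl)ᶜ, A ℓ) * ∏ υ ∈ univ.erase υ₀, q υ) := by
    intro σ
    have hl : ∏ ℓ, P ℓ (σ (src ℓ)) (σ (tgt ℓ))
        = (∏ i, F.orient P i (σ (F.lo i)) (σ i.succ)) * ∏ ℓ ∈ (univ.image F.tl)ᶜ, P ℓ (σ (src ℓ)) (σ (tgt ℓ)) := by
      rw [← prod_mul_prod_compl (univ.image F.tl), prod_image fun i _ j _ h => F.tl_injective h]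
      exact congrArg (· * _) (prod_congr rfl fun i _ => F.line_eq_orient P i σ)
    have hv : ∏ υ, p υ (σ (vtx υ)) = p υ₀ (σ 0) * ∏ υ ∈ univ.erase υ₀, p υ (σ (vtx υ)) := by
      rw [← mul_prod_erase univ (fun υ => p υ (σ (vtx υ))) (mem_univ υ₀), hυ₀]
    rw [hl, hv]
    have h1 : ∏ ℓ ∈ (univ.image F.tl)ᶜ, P ℓ (σ (src ℓ)) (σ (tgt ℓ)) ≤ ∏ ℓ ∈ (univ.image F.tl)ᶜ, A ℓ :=
      prod_le_prod (fun ℓ _ => hP0 _ _ _) fun ℓ hℓ => hA ℓ (mem_compl.1 hℓ) _ _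
    have h2 : ∏ υ ∈ univ.erase υ₀, p υ (σ (vtx υ)) ≤ ∏ υ ∈ univ.erase υ₀, q υ :=
      prod_le_prod (fun υ _ => hp0 _ _) fun υ hυ => hq υ (ne_of_mem_erase hυ) _
    have hT0 : 0 ≤ ∏ i, F.orient P i (σ (F.lo i)) (σ i.succ) := prod_nonneg fun i _ => hK0 _ _ _
    calc (∏ i, F.orient P i (σ (F.lo i)) (σ i.succ)) * (∏ ℓ ∈ (univ.image F.tl)ᶜ, P ℓ (σ (src ℓ)) (σ (tgt ℓ)))
            * (p υ₀ (σ 0) * ∏ υ ∈ univ.erase υ₀, p υ (σ (vtx υ)))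
        ≤ (∏ i, F.orient P i (σ (F.lo i)) (σ i.succ)) * (∏ ℓ ∈ (univ.image F.tl)ᶜ, A ℓ)
            * (p υ₀ (σ 0) * ∏ υ ∈ univ.erase υ₀, q υ) :=
          mul_le_mul (mul_le_mul_of_nonneg_left h1 hT0) (mul_le_mul_of_nonneg_left h2 (hp0 _ _))
            (mul_nonneg (hp0 _ _) (prod_nonneg fun υ _ => hp0 _ _)) (mul_nonneg hT0 hA0)
      _ = _ := by ring
  -- the placement split `σ = (x, τ)` and §1
  have hsplit : ∑ σ : Fin (n + 1) → S, ω ^ (n + 1) * (p υ₀ (σ 0) * ∏ i, F.orient P i (σ (F.lo i)) (σ i.succ))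
      = ∑ x : S, ω * p υ₀ x * treePin n ω (F.orient P) F.lo x := by
    rw [← (Fin.consEquiv fun _ => S).sum_comp, Fintype.sum_prod_type]
    refine sum_congr rfl fun x _ => ?_
    unfold treePin
    rw [mul_sum]
    refine sum_congr rfl fun τ _ => ?_
    have hcons : ((Fin.consEquiv fun _ => S) (x, τ) : Fin (n + 1) → S) = Fin.cons x τ := rfl
    rw [hcons, Fin.cons_zero, pow_succ]
    ring
  -- assemble
  unfold graphValLS
  rw [Fintype.card_fin]
  calc ∑ σ : Fin (n + 1) → S, ω ^ (n + 1) * ((∏ ℓ, P ℓ (σ (src ℓ)) (σ (tgt ℓ))) * ∏ υ, p υ (σ (vtx υ)))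
      ≤ ∑ σ : Fin (n + 1) → S, ω ^ (n + 1) * ((p υ₀ (σ 0) * ∏ i, F.orient P i (σ (F.lo i)) (σ i.succ))
            * ((∏ ℓ ∈ (univ.image F.tl)ᶜ, A ℓ) * ∏ υ ∈ univ.erase υ₀, q υ)) :=
        sum_le_sum fun σ _ => mul_le_mul_of_nonneg_left (hpt σ) (pow_nonneg hω _)
    _ = (∑ x : S, ω * p υ₀ x * treePin n ω (F.orient P) F.lo x) * ((∏ ℓ ∈ (univ.image F.tl)ᶜ, A ℓ) * ∏ υ ∈ univ.erase υ₀, q υ) := by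
        rw [← hsplit, sum_mul]
        exact sum_congr rfl fun σ _ => by ring
    _ ≤ (∑ x : S, ω * p υ₀ x * ∏ i, c i) * ((∏ ℓ ∈ (univ.image F.tl)ᶜ, A ℓ) * ∏ υ ∈ univ.erase υ₀, q υ) := by
        refine mul_le_mul_of_nonneg_right (sum_le_sum fun x _ => ?_) (mul_nonneg hA0 hq0)
        exact mul_le_mul_of_nonneg_left (htree x) (mul_nonneg hω (hp0 _ _))
    _ ≤ (Γ * ∏ i, c i) * ((∏ ℓ ∈ (univ.image F.tl)ᶜ, A ℓ) * ∏ υ ∈ univ.erase υ₀, q υ) := by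
        rw [← sum_mul]
        exact mul_le_mul_of_nonneg_right (mul_le_mul_of_nonneg_right hΓ hc0) (mul_nonneg hA0 hq0)
    _ = Γ * ((∏ ℓ ∈ (univ.image F.tl)ᶜ, A ℓ) * (∏ i, c i) * ∏ υ ∈ univ.erase υ₀, q υ) := by ring

end Forest

/-! ## §3 The sum over orderings (3.58)–(3.59) -/

section Orderings
variable {m : ℕ} {β : Type*} [LinearOrder β] [Fintype β]

open Classical in
/-- ★ **«REWRITTEN AS A SUM OVER ORDERINGS l = {l(1), …, l(m)} OF THE m INTERNAL LINES … FOLLOWED BY A SUM OVER INTEGERS {j_{l(p)}} COMPATIBLE WITH THIS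
ORDERING»** ((3.58)–(3.59)): for nonnegative `F`, `Σ_{j : Fin m → β} F j ≤ Σ_{π : Perm (Fin m)} Σ_{j : j ∘ π monotone} F j` — every slice assignment `j` is
compatible with at least one ordering (`Tuple.sort j`); King assigns ties to ONE compatible ordering (equality), the inequality double-counts them, which
is all the bound needs. [cite: King1986, (3.58)–(3.59) p.663] -/
theorem sum_le_sum_perm_monotone (F : (Fin m → β) → ℝ) (hF : ∀ j, 0 ≤ F j) :
    ∑ j : Fin m → β, F j ≤ ∑ π : Equiv.Perm (Fin m), ∑ j : Fin m → β, (if Monotone (j ∘ ⇑π) then F j else 0) := by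
  rw [sum_comm]
  refine sum_le_sum fun j _ => ?_
  have hmono : Monotone (j ∘ ⇑(Tuple.sort j)) := Tuple.monotone_sort j
  calc F j = if Monotone (j ∘ ⇑(Tuple.sort j)) then F j else 0 := by rw [if_pos hmono]
    _ ≤ ∑ π : Equiv.Perm (Fin m), (if Monotone (j ∘ ⇑π) then F j else 0) :=
        single_le_sum (f := fun π : Equiv.Perm (Fin m) => if Monotone (j ∘ ⇑π) then F j else 0)
          (fun π _ => by
            show (0 : ℝ) ≤ if Monotone (j ∘ ⇑π) then F j else 0
            split_ifs
            · exact hF j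
            · exact le_rfl)
          (mem_univ (Tuple.sort j))

omit [LinearOrder β] [Fintype β] in
/-- **re-indexing the slice assignments along an ordering**: `j ↦ j ∘ π` is a bijection of `Fin m → β`, so `Σ_j G (j ∘ π) = Σ_j G j`. [folklore] -/
theorem sum_comp_perm_eq [Fintype β] {M : Type*} [AddCommMonoid M] (π : Equiv.Perm (Fin m)) (G : (Fin m → β) → M) :
    ∑ j : Fin m → β, G (j ∘ ⇑π) = ∑ j : Fin m → β, G j :=
  Equiv.sum_comp
    ({ toFun := fun j => j ∘ ⇑π, invFun := fun j => j ∘ ⇑π.symm,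
       left_inv := fun j => funext fun p => by simp only [Function.comp_apply, Equiv.apply_symm_apply],
       right_inv := fun j => funext fun p => by simp only [Function.comp_apply, Equiv.symm_apply_apply] } :
      (Fin m → β) ≃ (Fin m → β)) G

omit [LinearOrder β] [Fintype β] in
/-- **re-indexing the lines along an ordering**: `Π_ℓ f ℓ = Π_p f (π p)`. [folklore] -/
theorem prod_comp_perm_eq {M : Type*} [CommMonoid M] (π : Equiv.Perm (Fin m)) (f : Fin m → M) :
    ∏ p : Fin m, f (π p) = ∏ ℓ : Fin m, f ℓ :=
  Equiv.prod_comp π f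

end Orderings

end Summit.QuantumFields.YangMills.BalabanUVNodes.N15KingModelRung.Graph

end
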